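import Mathlib
import Summits.MatrixMultiplication.MatrixMultiplication.Theorems.SnSubsetDichotomyPolynomialSlackMatchingCells
import Summits.MatrixMultiplication.MatrixMultiplication.Theorems.SnSubsetDichotomyPolynomialSlackMatchingCostAvoidEps
import Summits.MatrixMultiplication.MatrixMultiplication.Theorems.SnSubsetDichotomyPolynomialSlackMatchingCostHitEps
import Summits.MatrixMultiplication.MatrixMultiplication.Theorems.SnSubsetDichotomyPolynomialSlackDepletedCellLevel

/-!
# The cost of an `ε`-depleted matching (3/4 step, scattered branch without sharp mass)

Crux `Summit.MatrixMultiplication.MatrixMultiplication.Theses.SnSubsetDichotomy.PolynomialSlack`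
(item `stmt-MatrixMultiplication-8306`), level-one programme, line transport-split-hull (lead c10).
Generalises c8's `matchingCells_card_le` (cells depleted to `1/128` of uniform, `A, B` dense) to cells
that are only `ε`-DEPLETED (`n Σ_j dA(i,j) dB(j,k) ≤ 1 - ε`) and to arbitrary `A = S⁻¹T`, `B = T⁻¹U`:
a matching `Mt` of such cells `e = (k, i)` (distinct first and distinct second coordinates) has at most
`576 (1+log n) (log(8 K_A/ε') + log(8 K_B/ε'))/ε'³` cells, `ε' = ε²/(12(1+log n)(2+log(1/ε)))`,
`K_A = n!/(|S||T|)`, `K_B = n!/(|T||U|)`.  Per cell, `depleted_cell_level` (row `p = dA(i,·)` of `A`,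
column `q = dB(·,k)` of `B`, both probability vectors) gives a set `L_e` with `Σ_{L_e} dB(·,k) ≥ ε'` and
`Σ_{L_e} dA(i,·) ≤ (1-ε')|L_e|/n`.  Cells with `|L_e| ≥ ε' n/2` make `A` avoid `L_e` at the distinct rows
`i` (`#{a ∈ A : a⁻¹ i ∈ L_e} = |A| Σ_{j ∈ L_e} dA(i,j)`): `matching_cost_avoid_eps` bounds `Σ |L_e|/n`,
hence their number by `288 (1+log n) log(4K_A/ε')/ε'³`; cells with `|L_e| < ε' n/2` make `B` over-hit
`L_e` at the distinct positions `k` with excess `≥ ε'/2` each: `matching_cost_hit_eps` (with `ε'/2`)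
bounds their number by `576 (1+log n) log(8 K_B/ε')/ε'²`.
-/

namespace Summit.MatrixMultiplication.MatrixMultiplication.Theorems.PolynomialSlack

open scoped BigOperators
open Literature.Combinatorics.Additive (TripleProductProperty)

set_option linter.dupNamespace false

/-! ## Finset-indexed forms of the two `ε`-matching costs -/

-- adapted from `matchingCells_cost_avoid` (…PolynomialSlackMatchingCells, private)
/-- `matching_cost_avoid_eps` for a family of cells indexed by a finset `C` (reindex along
`C.equivFin`), each set of relative size at least `δ`: `|C| δ ≤ 144 (1+log n) log(4 (n!/|A|)/ε)/ε²`.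
[folklore] -/
private theorem matchingCellsEps_cost_avoid {n : ℕ} (hn : 1 ≤ n) (A : Finset (Equiv.Perm (Fin n)))
    (hA : A.Nonempty) {ι : Type*} (C : Finset ι) (row : ι → Fin n)
    (hrow : Set.InjOn row (C : Set ι)) (Q : ι → Finset (Fin n)) (ε : ℝ) (hε : 0 < ε)
    (hε1 : ε ≤ 1) (δ : ℝ) (hQ : ∀ c ∈ C, δ ≤ ((Q c).card : ℝ) / n)
    (havoid : ∀ c ∈ C, ((A.filter fun a => a⁻¹ (row c) ∈ Q c).card : ℝ) ≤
      (1 - ε) * ((Q c).card : ℝ) / n * A.card) :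
    (C.card : ℝ) * δ ≤
      144 * (1 + Real.log n) * Real.log (4 * ((n.factorial : ℝ) / A.card) / ε) / ε ^ 2 := by
  set φ := C.equivFin with hφ
  have hinj : Function.Injective fun c : Fin C.card => row (φ.symm c).1 := by
    intro c₁ c₂ h
    have h' : (φ.symm c₁).1 = (φ.symm c₂).1 := hrow (φ.symm c₁).2 (φ.symm c₂).2 h
    exact φ.symm.injective (Subtype.ext h')
  have h := matching_cost_avoid_eps hn A hA (fun c => row (φ.symm c).1) hinj
    (fun c => Q (φ.symm c).1) ε hε hε1 (fun c => havoid _ (φ.symm c).2)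
  have hs : (C.card : ℝ) * δ ≤ ∑ c : Fin C.card, ((Q (φ.symm c).1).card : ℝ) / n := by
    calc (C.card : ℝ) * δ = ∑ _c : Fin C.card, δ := by
          rw [Finset.sum_const, Finset.card_univ, Fintype.card_fin, nsmul_eq_mul]
      _ ≤ ∑ c : Fin C.card, ((Q (φ.symm c).1).card : ℝ) / n :=
          Finset.sum_le_sum fun c _ => hQ _ (φ.symm c).2
  exact hs.trans h

-- adapted from `matchingCells_cost_hit` (…PolynomialSlackMatchingCells, private)
/-- `matching_cost_hit_eps` for a family of cells indexed by a finset `C` (reindex along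
`C.equivFin`), each set over-hit with excess `ε`: `|C| ≤ 144 (1+log n) log(4 (n!/|B|)/ε)/ε²`.
[folklore] -/
private theorem matchingCellsEps_cost_hit {n : ℕ} (hn : 1 ≤ n) (B : Finset (Equiv.Perm (Fin n)))
    (hB : B.Nonempty) {ι : Type*} (C : Finset ι) (col : ι → Fin n)
    (hcol : Set.InjOn col (C : Set ι)) (Q : ι → Finset (Fin n)) (ε : ℝ) (hε : 0 < ε)
    (hε1 : ε ≤ 1)
    (hhit : ∀ c ∈ C, ((Q c).card : ℝ) / n + ε ≤
      ((B.filter fun b => b (col c) ∈ Q c).card : ℝ) / B.card) :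
    (C.card : ℝ) ≤
      144 * (1 + Real.log n) * Real.log (4 * ((n.factorial : ℝ) / B.card) / ε) / ε ^ 2 := by
  set φ := C.equivFin with hφ
  have hinj : Function.Injective fun c : Fin C.card => col (φ.symm c).1 := by
    intro c₁ c₂ h
    have h' : (φ.symm c₁).1 = (φ.symm c₂).1 := hcol (φ.symm c₁).2 (φ.symm c₂).2 h
    exact φ.symm.injective (Subtype.ext h')
  have hsum : ∑ c : Fin C.card, ((Q (φ.symm c).1).card : ℝ) / n + (C.card : ℝ) * ε ≤
      ∑ c : Fin C.card,
        ((B.filter fun b => b (col (φ.symm c).1) ∈ Q (φ.symm c).1).card : ℝ) / B.card := by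
    have h1 : (C.card : ℝ) * ε = ∑ _c : Fin C.card, ε := by
      rw [Finset.sum_const, Finset.card_univ, Fintype.card_fin, nsmul_eq_mul]
    rw [h1, ← Finset.sum_add_distrib]
    exact Finset.sum_le_sum fun c _ => hhit _ (φ.symm c).2
  exact matching_cost_hit_eps hn B hB (fun c => col (φ.symm c).1) hinj
    (fun c => Q (φ.symm c).1) ε hε hε1 hsum

/-! ## Profiles of the quotient sets -/

-- adapted from `matchingCells_colsum` (…PolynomialSlackMatchingCells, private)
/-- The columns of the profile `dB(j,k) = #{(t,u) : u k = t j}/(|T||U|)` sum to `1`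
(`sum_pairMarginal_fst`). [folklore] -/
private theorem matchingCellsEps_colsum {n : ℕ} {T U : Finset (Equiv.Perm (Fin n))}
    (hpos : 0 < T.card * U.card) (dB : Fin n → Fin n → ℝ)
    (hdB : ∀ j k, dB j k =
      (((T ×ˢ U).filter fun tu => tu.2 k = tu.1 j).card : ℝ) / (T.card * U.card : ℕ))
    (k : Fin n) : ∑ j, dB j k = 1 := by
  have hc : ((T.card * U.card : ℕ) : ℝ) ≠ 0 := by exact_mod_cast hpos.ne'
  simp_rw [hdB]
  rw [← Finset.sum_div, div_eq_one_iff_eq hc]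
  exact_mod_cast sum_pairMarginal_fst T U k

/-- The rows of the profile `dA(i,j) = #{(s,t) : t j = s i}/(|S||T|)` sum to `1`
(`sum_pairMarginal_snd`). [folklore] -/
private theorem matchingCellsEps_rowsum {n : ℕ} {S T : Finset (Equiv.Perm (Fin n))}
    (hpos : 0 < S.card * T.card) (dA : Fin n → Fin n → ℝ)
    (hdA : ∀ i j, dA i j =
      (((S ×ˢ T).filter fun st => st.2 j = st.1 i).card : ℝ) / (S.card * T.card : ℕ))
    (i : Fin n) : ∑ j, dA i j = 1 := by
  have hc : ((S.card * T.card : ℕ) : ℝ) ≠ 0 := by exact_mod_cast hpos.ne'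
  simp_rw [hdA]
  rw [← Finset.sum_div, div_eq_one_iff_eq hc]
  exact_mod_cast sum_pairMarginal_snd S T i

-- adapted from `matchingCells_avoid_count` (…PolynomialSlackMatchingCells, private)
/-- Avoidance count through the profile: `#{a ∈ S⁻¹T : a⁻¹ i ∈ I} = |S||T| · Σ_{j ∈ I} dA(i,j)`
(`card_filter_inv_apply_mem` and `pairMarginal_eq_marginal_image₂`). [folklore] -/
private theorem matchingCellsEps_avoid_count {n : ℕ} {S T : Finset (Equiv.Perm (Fin n))}
    (hinj : Set.InjOn (fun xy : Equiv.Perm (Fin n) × Equiv.Perm (Fin n) => xy.1⁻¹ * xy.2)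
      (↑S ×ˢ ↑T : Set (Equiv.Perm (Fin n) × Equiv.Perm (Fin n))))
    (dA : Fin n → Fin n → ℝ)
    (hdA : ∀ i j, dA i j =
      (((S ×ˢ T).filter fun st => st.2 j = st.1 i).card : ℝ) / (S.card * T.card : ℕ))
    (hpos : 0 < S.card * T.card) (i : Fin n) (I : Finset (Fin n)) :
    (((Finset.image₂ (fun x y : Equiv.Perm (Fin n) => x⁻¹ * y) S T).filter
        fun a => a⁻¹ i ∈ I).card : ℝ) = (S.card * T.card : ℕ) * ∑ j ∈ I, dA i j := by
  have hc : ((S.card * T.card : ℕ) : ℝ) ≠ 0 := by exact_mod_cast hpos.ne'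
  rw [card_filter_inv_apply_mem, Nat.cast_sum, Finset.mul_sum]
  refine Finset.sum_congr rfl fun j _ => ?_
  rw [hdA, pairMarginal_eq_marginal_image₂ hinj i j, mul_div_assoc', mul_div_cancel_left₀ _ hc]

-- adapted from `matchingCells_card_filter_apply_mem` (…PolynomialSlackMatchingCells, private)
/-- Fibring over the value: `#{b ∈ X : b k ∈ I} = Σ_{j ∈ I} #{b ∈ X : b k = j}`. [folklore] -/
private theorem matchingCellsEps_card_filter_apply_mem {n : ℕ} (X : Finset (Equiv.Perm (Fin n)))
    (I : Finset (Fin n)) (k : Fin n) :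
    (X.filter fun b => b k ∈ I).card = ∑ j ∈ I, (X.filter fun b => b k = j).card := by
  classical
  rw [Finset.card_eq_sum_card_fiberwise (f := fun b : Equiv.Perm (Fin n) => b k)
    (s := X.filter fun b => b k ∈ I) (t := I) (fun b hb => (Finset.mem_filter.1 hb).2)]
  refine Finset.sum_congr rfl fun j hj => ?_
  congr 1
  ext b
  simp only [Finset.mem_filter]
  constructor
  · rintro ⟨⟨hb, _⟩, h⟩
    exact ⟨hb, h⟩
  · rintro ⟨hb, h⟩
    exact ⟨⟨hb, by rw [h]; exact hj⟩, h⟩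

-- adapted from `matchingCells_hit_count` (…PolynomialSlackMatchingCells, private)
/-- Hit count through the profile: `#{b ∈ T⁻¹U : b k ∈ I} = |T||U| · Σ_{j ∈ I} dB(j,k)`
(fibring over the value `b k` and `pairMarginal_eq_marginal_image₂`). [folklore] -/
private theorem matchingCellsEps_hit_count {n : ℕ} {T U : Finset (Equiv.Perm (Fin n))}
    (hinj : Set.InjOn (fun xy : Equiv.Perm (Fin n) × Equiv.Perm (Fin n) => xy.1⁻¹ * xy.2)
      (↑T ×ˢ ↑U : Set (Equiv.Perm (Fin n) × Equiv.Perm (Fin n))))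
    (dB : Fin n → Fin n → ℝ)
    (hdB : ∀ j k, dB j k =
      (((T ×ˢ U).filter fun tu => tu.2 k = tu.1 j).card : ℝ) / (T.card * U.card : ℕ))
    (hpos : 0 < T.card * U.card) (k : Fin n) (I : Finset (Fin n)) :
    (((Finset.image₂ (fun x y : Equiv.Perm (Fin n) => x⁻¹ * y) T U).filter
        fun b => b k ∈ I).card : ℝ) = (T.card * U.card : ℕ) * ∑ j ∈ I, dB j k := by
  have hc : ((T.card * U.card : ℕ) : ℝ) ≠ 0 := by exact_mod_cast hpos.ne'
  rw [matchingCellsEps_card_filter_apply_mem, Nat.cast_sum, Finset.mul_sum]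
  refine Finset.sum_congr rfl fun j _ => ?_
  rw [hdB, pairMarginal_eq_marginal_image₂ hinj j k, mul_div_assoc', mul_div_cancel_left₀ _ hc]

/-! ## The registered stub -/

/-- **Cost of an `ε`-depleted matching.** For a TPP triple `S, T, U ⊆ S_n` (`n ≥ 2`) with quotient
profiles `dA, dB` and a matching `Mt` of cells `e = (k, i)` with `n Σ_j dA(i,j) dB(j,k) ≤ 1 - ε`
(`0 < ε ≤ 1`):
`|Mt| ≤ 576 (1+log n) (log (8 K_A/ε') + log (8 K_B/ε'))/ε'³`, `ε' = ε²/(12(1+log n)(2+log(1/ε)))`.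
[folklore] -/
theorem matchingCells_card_le_eps {n : ℕ} (hn : 2 ≤ n) {S T U : Finset (Equiv.Perm (Fin n))}
    (hTPP : TripleProductProperty S T U) (hS0 : S.Nonempty) (hT0 : T.Nonempty) (hU0 : U.Nonempty)
    (dA dB : Fin n → Fin n → ℝ)
    (hdA : ∀ i j, dA i j =
      (((S ×ˢ T).filter fun st => st.2 j = st.1 i).card : ℝ) / (S.card * T.card : ℕ))
    (hdB : ∀ j k, dB j k =
      (((T ×ˢ U).filter fun tu => tu.2 k = tu.1 j).card : ℝ) / (T.card * U.card : ℕ))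
    (ε : ℝ) (hε : 0 < ε) (hε1 : ε ≤ 1)
    (Mt : Finset (Fin n × Fin n)) (h1 : Set.InjOn Prod.fst (Mt : Set (Fin n × Fin n)))
    (h2 : Set.InjOn Prod.snd (Mt : Set (Fin n × Fin n)))
    (hdep : ∀ e ∈ Mt, (n : ℝ) * ∑ j : Fin n, dA e.2 j * dB j e.1 ≤ 1 - ε) :
    (Mt.card : ℝ) ≤ 576 * (1 + Real.log n) *
      (Real.log (8 * ((n.factorial : ℝ) / (S.card * T.card : ℕ)) /
          (ε ^ 2 / (12 * (1 + Real.log n) * (2 + Real.log (1 / ε))))) +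
        Real.log (8 * ((n.factorial : ℝ) / (T.card * U.card : ℕ)) /
          (ε ^ 2 / (12 * (1 + Real.log n) * (2 + Real.log (1 / ε)))))) /
      (ε ^ 2 / (12 * (1 + Real.log n) * (2 + Real.log (1 / ε)))) ^ 3 := by
  -- injectivity of the two quotient maps (the triple product property) and basic positivity
  have hinjA := injOn_quot_first hTPP hU0
  have hinjB := injOn_quot_second hTPP hS0
  have hSTpos : 0 < S.card * T.card := mul_pos hS0.card_pos hT0.card_pos
  have hTUpos : 0 < T.card * U.card := mul_pos hT0.card_pos hU0.card_pos
  have hSTR : (0 : ℝ) < (S.card * T.card : ℕ) := by exact_mod_cast hSTpos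
  have hTUR : (0 : ℝ) < (T.card * U.card : ℕ) := by exact_mod_cast hTUpos
  have hn1 : 1 ≤ n := le_trans (by norm_num) hn
  have hnR : (1 : ℝ) ≤ n := by exact_mod_cast hn1
  have hn0 : (0 : ℝ) < n := by linarith
  have hdA0 : ∀ i j, 0 ≤ dA i j := fun i j => by rw [hdA]; positivity
  have hdB0 : ∀ j k, 0 ≤ dB j k := fun j k => by rw [hdB]; positivity
  have hrowsum : ∀ i, ∑ j, dA i j = 1 := matchingCellsEps_rowsum hSTpos dA hdA
  have hcolsum : ∀ k, ∑ j, dB j k = 1 := matchingCellsEps_colsum hTUpos dB hdB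
  -- the quotient sets `A = S⁻¹T`, `B = T⁻¹U`, their sizes, and `K_A, K_B ≥ 1`
  have hAcard := card_image₂_of_injOn' hinjA
  have hBcard := card_image₂_of_injOn' hinjB
  have hAne : (Finset.image₂ (fun x y : Equiv.Perm (Fin n) => x⁻¹ * y) S T).Nonempty :=
    hS0.image₂ hT0
  have hBne : (Finset.image₂ (fun x y : Equiv.Perm (Fin n) => x⁻¹ * y) T U).Nonempty :=
    hT0.image₂ hU0
  have hAle : ((S.card * T.card : ℕ) : ℝ) ≤ n.factorial := by
    have : (Finset.image₂ (fun x y : Equiv.Perm (Fin n) => x⁻¹ * y) S T).card ≤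
        Fintype.card (Equiv.Perm (Fin n)) := Finset.card_le_univ _
    rw [Fintype.card_perm, Fintype.card_fin, hAcard] at this
    exact_mod_cast this
  have hBle : ((T.card * U.card : ℕ) : ℝ) ≤ n.factorial := by
    have : (Finset.image₂ (fun x y : Equiv.Perm (Fin n) => x⁻¹ * y) T U).card ≤
        Fintype.card (Equiv.Perm (Fin n)) := Finset.card_le_univ _
    rw [Fintype.card_perm, Fintype.card_fin, hBcard] at this
    exact_mod_cast this
  have hKA1 : 1 ≤ (n.factorial : ℝ) / (S.card * T.card : ℕ) := by
    rw [le_div_iff₀ hSTR, one_mul]; exact hAle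
  have hKB1 : 1 ≤ (n.factorial : ℝ) / (T.card * U.card : ℕ) := by
    rw [le_div_iff₀ hTUR, one_mul]; exact hBle
  -- the depletion parameter `ε' = ε²/(12 (1 + log n) (2 + log (1/ε))) ∈ (0, 1]`
  have hlogn : 0 ≤ Real.log n := Real.log_nonneg hnR
  have hlogε : 0 ≤ Real.log (1 / ε) := Real.log_nonneg ((one_le_div hε).2 hε1)
  have hD : 24 ≤ 12 * (1 + Real.log n) * (2 + Real.log (1 / ε)) := by
    nlinarith [mul_nonneg hlogn hlogε]
  set ε' : ℝ := ε ^ 2 / (12 * (1 + Real.log n) * (2 + Real.log (1 / ε))) with hε'_def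
  have hε'0 : 0 < ε' := div_pos (pow_pos hε 2) (by linarith)
  have hε'1 : ε' ≤ 1 := by
    rw [hε'_def, div_le_one (by linarith)]
    nlinarith
  have hε'h0 : 0 < ε' / 2 := by linarith
  have hε'h1 : ε' / 2 ≤ 1 := by linarith
  -- per cell, the level set `L e` of `depleted_cell_level`
  have hex : ∀ e ∈ Mt, ∃ L : Finset (Fin n), ε' ≤ ∑ j ∈ L, dB j e.1 ∧
      ∑ j ∈ L, dA e.2 j ≤ (1 - ε') * (L.card : ℝ) / n := by
    intro e he
    have hdep' : ∑ j, dA e.2 j * dB j e.1 ≤ (1 - ε) / n := by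
      rw [le_div_iff₀ hn0, mul_comm]; exact hdep e he
    exact depleted_cell_level hn (fun j => dA e.2 j) (fun j => dB j e.1) (fun j => hdA0 _ _)
      (fun j => hdB0 _ _) (hrowsum e.2) (hcolsum e.1) ε hε hε1 hdep'
  choose! L hLB hLA using hex
  -- split the matching by the size of `L e`
  have hsplit := Finset.card_filter_add_card_filter_not (s := Mt)
    (fun e => ε' * n / 2 ≤ ((L e).card : ℝ))
  have hsum : ((Mt.filter fun e => ε' * n / 2 ≤ ((L e).card : ℝ)).card : ℝ) +
      ((Mt.filter fun e => ¬ (ε' * n / 2 ≤ ((L e).card : ℝ))).card : ℝ) = Mt.card := by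
    exact_mod_cast hsplit
  -- big cells: `A = S⁻¹T` avoids `L e` at the distinct rows `i = e.2`
  have hbig : ((Mt.filter fun e => ε' * n / 2 ≤ ((L e).card : ℝ)).card : ℝ) * (ε' / 2) ≤
      144 * (1 + Real.log n) *
        Real.log (4 * ((n.factorial : ℝ) / (S.card * T.card : ℕ)) / ε') / ε' ^ 2 := by
    have h := matchingCellsEps_cost_avoid hn1 _ hAne
      (Mt.filter fun e => ε' * n / 2 ≤ ((L e).card : ℝ)) Prod.snd
      (h2.mono (Finset.coe_subset.2 (Finset.filter_subset _ _))) L ε' hε'0 hε'1 (ε' / 2)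
      (fun e he => by
        have hge := (Finset.mem_filter.1 he).2
        rw [le_div_iff₀ hn0]
        linarith)
      (fun e he => by
        rw [matchingCellsEps_avoid_count hinjA dA hdA hSTpos, hAcard]
        have hle := hLA e (Finset.mem_filter.1 he).1
        calc ((S.card * T.card : ℕ) : ℝ) * ∑ j ∈ L e, dA e.2 j
            ≤ ((S.card * T.card : ℕ) : ℝ) * ((1 - ε') * ((L e).card : ℝ) / n) :=
              mul_le_mul_of_nonneg_left hle hSTR.le
          _ = (1 - ε') * ((L e).card : ℝ) / n * ((S.card * T.card : ℕ) : ℝ) := by ring)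
    rw [hAcard] at h
    exact h
  -- small cells: `B = T⁻¹U` over-hits `L e` at the distinct positions `k = e.1`, excess `ε'/2`
  have hsmall : ((Mt.filter fun e => ¬ (ε' * n / 2 ≤ ((L e).card : ℝ))).card : ℝ) ≤
      144 * (1 + Real.log n) *
        Real.log (4 * ((n.factorial : ℝ) / (T.card * U.card : ℕ)) / (ε' / 2)) / (ε' / 2) ^ 2 := by
    have h := matchingCellsEps_cost_hit hn1 _ hBne
      (Mt.filter fun e => ¬ (ε' * n / 2 ≤ ((L e).card : ℝ))) Prod.fst
      (h1.mono (Finset.coe_subset.2 (Finset.filter_subset _ _))) L (ε' / 2) hε'h0 hε'h1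
      (fun e he => by
        have hlt := not_le.1 (Finset.mem_filter.1 he).2
        have hge := hLB e (Finset.mem_filter.1 he).1
        rw [matchingCellsEps_hit_count hinjB dB hdB hTUpos, hBcard,
          mul_div_cancel_left₀ _ hTUR.ne']
        have h3 : ((L e).card : ℝ) / n < ε' / 2 := by
          rw [div_lt_iff₀ hn0]
          linarith
        linarith)
    rw [hBcard] at h
    exact h
  -- the logarithms: `0 ≤ log(4 K_A/ε') ≤ log(8 K_A/ε')`, `0 ≤ log(8 K_B/ε') = log(4 K_B/(ε'/2))`
  have h8 : 4 * ((n.factorial : ℝ) / (T.card * U.card : ℕ)) / (ε' / 2) =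
      8 * ((n.factorial : ℝ) / (T.card * U.card : ℕ)) / ε' := by
    rw [div_div_eq_mul_div]
    ring
  have hL4A : Real.log (4 * ((n.factorial : ℝ) / (S.card * T.card : ℕ)) / ε') ≤
      Real.log (8 * ((n.factorial : ℝ) / (S.card * T.card : ℕ)) / ε') := by
    apply Real.log_le_log (div_pos (by linarith) hε'0)
    exact div_le_div_of_nonneg_right (by linarith) hε'0.le
  have hLA0 : 0 ≤ Real.log (8 * ((n.factorial : ℝ) / (S.card * T.card : ℕ)) / ε') := by
    apply Real.log_nonneg
    rw [le_div_iff₀ hε'0]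
    linarith
  have hLB0 : 0 ≤ Real.log (8 * ((n.factorial : ℝ) / (T.card * U.card : ℕ)) / ε') := by
    apply Real.log_nonneg
    rw [le_div_iff₀ hε'0]
    linarith
  -- collect: `|Big| ε'³ ≤ 288 G log(4K_A/ε')`, `|Small| ε'³ ≤ |Small| ε'² ≤ 576 G log(8K_B/ε')`
  have key1 : ((Mt.filter fun e => ε' * n / 2 ≤ ((L e).card : ℝ)).card : ℝ) * ε' ^ 3 ≤
      288 * (1 + Real.log n) *
        Real.log (4 * ((n.factorial : ℝ) / (S.card * T.card : ℕ)) / ε') := by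
    rw [le_div_iff₀ (pow_pos hε'0 2)] at hbig
    have e1 : ((Mt.filter fun e => ε' * n / 2 ≤ ((L e).card : ℝ)).card : ℝ) * ε' ^ 3 =
        2 * (((Mt.filter fun e => ε' * n / 2 ≤ ((L e).card : ℝ)).card : ℝ) * (ε' / 2) *
          ε' ^ 2) := by ring
    linarith
  have key2 : ((Mt.filter fun e => ¬ (ε' * n / 2 ≤ ((L e).card : ℝ))).card : ℝ) * ε' ^ 2 ≤
      576 * (1 + Real.log n) *
        Real.log (8 * ((n.factorial : ℝ) / (T.card * U.card : ℕ)) / ε') := by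
    rw [h8, le_div_iff₀ (pow_pos hε'h0 2)] at hsmall
    have e2 : ((Mt.filter fun e => ¬ (ε' * n / 2 ≤ ((L e).card : ℝ))).card : ℝ) * ε' ^ 2 =
        4 * (((Mt.filter fun e => ¬ (ε' * n / 2 ≤ ((L e).card : ℝ))).card : ℝ) *
          (ε' / 2) ^ 2) := by ring
    linarith
  have key3 : ((Mt.filter fun e => ¬ (ε' * n / 2 ≤ ((L e).card : ℝ))).card : ℝ) * ε' ^ 3 ≤
      ((Mt.filter fun e => ¬ (ε' * n / 2 ≤ ((L e).card : ℝ))).card : ℝ) * ε' ^ 2 :=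
    mul_le_mul_of_nonneg_left (pow_le_pow_of_le_one hε'0.le hε'1 (by norm_num))
      (Nat.cast_nonneg _)
  have hGL4 : (1 + Real.log n) * Real.log (4 * ((n.factorial : ℝ) / (S.card * T.card : ℕ)) / ε') ≤
      (1 + Real.log n) * Real.log (8 * ((n.factorial : ℝ) / (S.card * T.card : ℕ)) / ε') :=
    mul_le_mul_of_nonneg_left hL4A (by linarith)
  have hGLA : 0 ≤ (1 + Real.log n) *
      Real.log (8 * ((n.factorial : ℝ) / (S.card * T.card : ℕ)) / ε') :=
    mul_nonneg (by linarith) hLA0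
  have e3 : (Mt.card : ℝ) * ε' ^ 3 =
      ((Mt.filter fun e => ε' * n / 2 ≤ ((L e).card : ℝ)).card : ℝ) * ε' ^ 3 +
        ((Mt.filter fun e => ¬ (ε' * n / 2 ≤ ((L e).card : ℝ))).card : ℝ) * ε' ^ 3 := by
    rw [← hsum]; ring
  rw [le_div_iff₀ (pow_pos hε'0 3)]
  linarith

end Summit.MatrixMultiplication.MatrixMultiplication.Theorems.PolynomialSlack
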